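/-
Copyright (c) 2026 the pub-hodgecm-mathlib formalisation cell (harness21).  Prover seat hodgecm-mathlib-K2E2-p12 (g5): Track B «K2-LIT», ENGINE E1,
h413 = stmt-HodgeConjecture-24833; (q10) «R7₃-SCALAR» FILE 3, brick (3-iv-c) «ASSEMBLY» (dealer K2E1-plan (g5) «=» 08:27Z ∕ 08:34Z).
-/
import Summits.HodgeConjecture.HodgeConjecture.Theorems.K2E1IntertwiningFiniteTransportU3        -- ★ (3-iv-b): the finite double integral of `h_f^{−σ}` as `C'·μ³(𝒪̂³)·(∏_{S₀} a_v)·N∕D`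
import Summits.HodgeConjecture.HodgeConjecture.Theorems.K2E1UnipotentHaarNormalisationU3      -- ★ (ν-1) p857963: `(ν𝓕)⁻¹ ∫_N T = μ_E(D_E)⁻¹ ∫_X μ_F(D_F)⁻¹ ∫_s T(u(X, θ s))`
import Summits.HodgeConjecture.HodgeConjecture.Theorems.K2E1HeightBigCellLineFormulaU3         -- ★ (a2)₃: `H(ι(w₀)u(X,θ(ι⁻¹s,b))k) = (∏_{w∣∞}(…) · h_f(X,b))⁻¹`
import Summits.HodgeConjecture.HodgeConjecture.Theorems.K2E1AdelicFourierEnvelope             -- ★ `exists_integral_adele_eq_smul_integral_prod` (`∫_𝔸 = c ∫∫_{∞ × f}`)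
import HarnessLib

/-!
# K2·E1 — `K2E1IntertwiningScalarEulerProductU3` ((q10) «R7₃-SCALAR» FILE 3, brick (3-iv-c) «ASSEMBLY»): THE UNRAMIFIED INTERTWINING INTEGRAL OF `U(2,1)` OVER A CM FIELD
# IS (ARCHIMEDEAN INTEGRAL) × (EULER PRODUCT) — `(ν𝓕)⁻¹·∫_{N(𝔸_{L⁺})} H(ι(w₀)v)^σ dν(v) = C · ARCH(σ) · (∏_{v ∈ S₀} a_v(σ)) · ζ^{S₀}(σ−1)L^{S₀}(σ−1,ε)L^{S₀}(2σ−2,ε) ∕ ζ^{S₀}(σ)L^{S₀}(σ,ε)L^{S₀}(2σ−1,ε)`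

Track B ∕ K2-LIT, crux h413 = `stmt-HodgeConjecture-24833`, route of record `HCCMUnconditional`; cell `hodgecm-mathlib`, squad K2, ENGINE E1 (campaign «EIS-RANK-ONE», R7 at
`N = 3`).  THEOREMS ONLY (no `def`, no instance, no notation, no `sorry`; default heartbeats); lane `--supports stmt-HodgeConjecture-24833 --as helper` (count-neutral).
THE CHAIN: ★ (ν-1) `inv_measure_smul_integral_eq_heisChart_traceZeroLine_three` (two-layer unfolding of `N(𝔸)` along the Heisenberg chart and the trace-zero line) ∘ ★ (a2)₃
`coe_borelHeight_weylLongU_heisChart_line_mul_eq_cm_three` (the height on the big cell at `k = 1`: archimedean place quadratics × the finite factor `h_f`) ∘ Mathlib `integral_prod_mul`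
twice along ★ `K2E1AdelicFourierEnvelope.exists_integral_adele_eq_smul_integral_prod` (`𝔸 = ∞ × f` for `L` and for `L⁺`) ∘ Mathlib `integral_prod` (the one place integrability is
used: letter `hfin`) ∘ ★ (3-iv-b) `exists_pos_integral_prod_heightFactor_rpow_eq` (= ★ (3-iv-a) ∘ ★ p858520 ∘ ★ (3-iii-b2) = ★ p858070 Tate 3.3.1 ∘ ★ (3-iii-b1) local means ∘
★ FILE 1 `hasProd_localScalar_three_cm`).
* §1 `rpow_borelHeight_weylLongU_heisChart_eq` — pointwise: `H(ι(w₀)·u(X, θ s))^σ = ARCH(X_∞, ι s_∞)^{−σ} · h_f(X, s_f)^{−σ}` (in `ℂ`).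
* §2 **`exists_pos_inv_measure_smul_integral_rpow_borelHeight_eq_eulerProduct_three`** (HEAD): ONE constant `C > 0` (Haar normalisations only) with, for every bad finset `S₀`
  (`hgood` off `S₀`), every real `σ > 2`, every `ν`-integrable `T_σ = H(ι(w₀)·)^σ` (`hT`, ★ Godement `K2E1IntertwiningGrowthU3` :183) whose finite part is integrable (`hfin`):
  `(ν𝓕)⁻¹ • ∫_{N(𝔸)} T_σ dν = C · ARCH(σ) · (∏_{v∈S₀} a_v(σ)) · N^{S₀}(σ)∕D^{S₀}(σ)`, `ARCH(σ) = ∫_{L_∞}∫_{L⁺_∞} (∏_{w∣∞}((1+½‖X_w‖²)² + (wδ)²s_w²))^{−σ}`, `N∕D` ★ FILE 1's VERBATIM.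
HONEST LABEL: HC_CM is proved only modulo the 7 printed citations (2 remaining named inputs: hLiu418 = `stmt-HodgeConjecture-24832`, h413 = `stmt-HodgeConjecture-24833`) until rung 0
closes; this file asserts no named fact and closes no socket; count-neutral; conditional only on its displayed letters (`hc`, `h𝓕`, `hgood`, `hT`, `hfin`).

## References
* [MoeglinWaldspurger1995] C. Mœglin, J.-L. Waldspurger, *Spectral Decomposition and Eisenstein Series* (1995): II.1.6–II.1.7, IV.1.11.
* [Langlands1971] R. P. Langlands, *Euler Products* (1971): §3.
* [Rogawski1990] J. D. Rogawski, *Automorphic Representations of Unitary Groups in Three Variables* (1990): §4.5, §7.3.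
* [TateThesis1967] J. Tate, *Fourier analysis in number fields and Hecke's zeta-functions* (1967): Thm 3.3.1.
* [Langlands1976] R. P. Langlands, *On the Functional Equations Satisfied by Eisenstein Series*, LNM 544 (1976): Appendix (rank one).
-/

set_option autoImplicit false
set_option linter.dupNamespace false -- the mandated namespace repeats `HodgeConjecture.HodgeConjecture`

noncomputable section

open MeasureTheory MeasureTheory.Measure NumberField NumberField.InfinitePlace IsDedekindDomain Filter
open scoped NNReal ENNReal Classical
open Literature.NumberTheory.Automorphic Literature.NumberTheory.Automorphic.UnitaryGroup Literature.NumberTheory.GaloisRepresentations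
open Literature.NumberTheory.GaloisRepresentations.IsNonarchimedeanLocalField
open Summit.HodgeConjecture.HodgeConjecture.Cruxes.H413
open Summit.HodgeConjecture.HodgeConjecture.Cruxes.H413.K2E1HeightBigCellLineFormulaU3 (coe_borelHeight_weylLongU_heisChart_line_mul_eq_cm_three)
open Summit.HodgeConjecture.HodgeConjecture.Cruxes.H413.K2E1UnipotentHaarNormalisationU3 (inv_measure_smul_integral_eq_heisChart_traceZeroLine_three)
open Summit.HodgeConjecture.HodgeConjecture.Cruxes.H413.K2E1AdelicFourierEnvelope (exists_integral_adele_eq_smul_integral_prod)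
open Summit.HodgeConjecture.HodgeConjecture.Cruxes.H413.K2E1IntertwiningFiniteTransportU3 (exists_pos_integral_prod_heightFactor_rpow_eq)

namespace Summit.HodgeConjecture.HodgeConjecture.Cruxes.H413.K2E1IntertwiningScalarEulerProductU3

variable (L : Type) [Field L] [NumberField L] [IsCMField L] (hc : IsCMField.complexConj L * IsCMField.complexConj L = 1)
  {δ : L} (hcδ : IsCMField.complexConj L δ = -δ) (hδ : δ ≠ 0)

/-! ## §1 Pointwise: the height to the power `σ` on the big cell is (archimedean product)^{−σ} × (finite factor)^{−σ} -/

/-- **`H(ι(w₀)·u(X, θ s))^σ = ARCH(X_∞, ι s_∞)^{−σ} · h_f(X, s_f)^{−σ}`** (in `ℂ`; ★ (a2)₃ at `k = 1`, `s_∞ = ι⁻¹(ι s_∞)`; both factors are `≥ 0`, so `(A·h)⁻¹` to the `σ` splits by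
`Real.inv_rpow`, `Real.mul_rpow`). [cite: MoeglinWaldspurger1995, II.1.7] [cite: Rogawski1990, §7.3] -/
theorem rpow_borelHeight_weylLongU_heisChart_eq (σ : ℝ) (X : AdeleRing (𝓞 L) L) (s : AdeleRing (𝓞 ↥(maximalRealSubfield L)) ↥(maximalRealSubfield L)) :
    ((((borelHeight (((quasiSplit (↥(maximalRealSubfield L)) L (IsCMField.complexConj L) 3).toAdelic (weylLongU ((IsCMField.complexConj L : L ≃ₐ[↥(maximalRealSubfield L)] L) : L →+* L) (rfl : ((StdForm.antidiagonal 3).over L) = ((StdForm.antidiagonal 3).over L)))) * (((heisChart hc (X, traceZeroLine ↥(maximalRealSubfield L) L (IsCMField.complexConj L) hcδ hδ s)) : ↥(adelicUnipotent ↥(maximalRealSubfield L) L (IsCMField.complexConj L) 3)) : (quasiSplit (↥(maximalRealSubfield L)) L (IsCMField.complexConj L) 3).Adelic))) : ℝ) ^ σ : ℝ) : ℂ) =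
      ((((∏ w : InfinitePlace L, ((1 + ‖(X.1) w‖ ^ 2 / 2) ^ 2 + (w δ) ^ 2 * (((InfiniteAdeleRing.ringEquiv_mixedSpace ↥(maximalRealSubfield L)) s.1).1 ⟨w.comap (algebraMap ↥(maximalRealSubfield L) L), K2E1HeightBigCellLineFormulaU2.isReal_comap_maximalRealSubfield L w⟩) ^ 2))) ^ (-σ) : ℝ) : ℂ) *
        ((((∏ᶠ w : HeightOneSpectrum (𝓞 L), max 1 (max ‖((X) : AdeleRing (𝓞 L) L).2 w‖₊
              ‖(heisZ (c := IsCMField.complexConj L) ((X) : AdeleRing (𝓞 L) L)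
                ((traceZeroLine ↥(maximalRealSubfield L) L (IsCMField.complexConj L) hcδ hδ
                  ((0, s.2) : AdeleRing (𝓞 ↥(maximalRealSubfield L)) ↥(maximalRealSubfield L)) :
                    traceZeroAdele ↥(maximalRealSubfield L) L (IsCMField.complexConj L)) : AdeleRing (𝓞 L) L)).2 w‖₊) : ℝ≥0) : ℝ) ^ (-σ) : ℝ) : ℂ) := by
  have h := coe_borelHeight_weylLongU_heisChart_line_mul_eq_cm_three L hc hcδ hδ
    (k := (1 : (quasiSplit (↥(maximalRealSubfield L)) L (IsCMField.complexConj L) 3).Adelic)) (Subgroup.one_mem _) X s.2 ((InfiniteAdeleRing.ringEquiv_mixedSpace ↥(maximalRealSubfield L)) s.1)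
  have hs : (((InfiniteAdeleRing.ringEquiv_mixedSpace ↥(maximalRealSubfield L)).symm ((InfiniteAdeleRing.ringEquiv_mixedSpace ↥(maximalRealSubfield L)) s.1), s.2) : AdeleRing (𝓞 ↥(maximalRealSubfield L)) ↥(maximalRealSubfield L)) = s := by
    rw [RingEquiv.symm_apply_apply]; rfl
  rw [hs, mul_one] at h
  have hA : (0 : ℝ) ≤ (∏ w : InfinitePlace L, ((1 + ‖(X.1) w‖ ^ 2 / 2) ^ 2 + (w δ) ^ 2 * (((InfiniteAdeleRing.ringEquiv_mixedSpace ↥(maximalRealSubfield L)) s.1).1 ⟨w.comap (algebraMap ↥(maximalRealSubfield L) L), K2E1HeightBigCellLineFormulaU2.isReal_comap_maximalRealSubfield L w⟩) ^ 2)) :=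
    Finset.prod_nonneg fun w _ => by positivity
  have hB : (0 : ℝ) ≤ (((∏ᶠ w : HeightOneSpectrum (𝓞 L), max 1 (max ‖((X) : AdeleRing (𝓞 L) L).2 w‖₊
              ‖(heisZ (c := IsCMField.complexConj L) ((X) : AdeleRing (𝓞 L) L)
                ((traceZeroLine ↥(maximalRealSubfield L) L (IsCMField.complexConj L) hcδ hδ
                  ((0, s.2) : AdeleRing (𝓞 ↥(maximalRealSubfield L)) ↥(maximalRealSubfield L)) :
                    traceZeroAdele ↥(maximalRealSubfield L) L (IsCMField.complexConj L)) : AdeleRing (𝓞 L) L)).2 w‖₊) : ℝ≥0)) : ℝ) := NNReal.coe_nonneg _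
  rw [h, Real.inv_rpow (mul_nonneg hA hB), ← Real.rpow_neg (mul_nonneg hA hB), Real.mul_rpow hA hB, Complex.ofReal_mul]

/-! ## §2 HEAD: the normalised unipotent integral of `H(ι(w₀)·)^σ` is `C · ARCH(σ) · (∏_{S₀} a_v(σ)) · N^{S₀}(σ)∕D^{S₀}(σ)` -/

include hc in
/-- **R7₃-SCALAR, ASSEMBLED: THE UNRAMIFIED INTERTWINING INTEGRAL OF `U(2,1)` OVER THE CM FIELD `L` IS (ARCHIMEDEAN INTEGRAL) × (EULER PRODUCT).**  For every Haar `ν` of the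
Heisenberg radical `N(𝔸_{L⁺})` with a fundamental domain `𝓕` for `N(L⁺)`, all additive Haar measures `μ_E, μ_{E,∞}, μ_{E,f}` (`E = L`) and `μ_F, μ_{F,∞}, μ_{F,f}` (`F = L⁺`) and local
Haar measures `ν_v`, there is ONE constant `C > 0` such that for every bad finset `S₀` (`hgood`: `v ∉ S₀` unramified in `L`, `|2|_v = 1`, `δ` a unit above `v`), every real
`σ > 2`, IF `v ↦ H(ι(w₀)·v)^σ` is `ν`-integrable (`hT` — ★ Godement `K2E1IntertwiningGrowthU3.integrable_borelHeight_weylLongU_mul_rpow`) and its finite part is integrable (`hfin`) THEN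
`(ν𝓕)⁻¹ • ∫_{N(𝔸)} H(ι(w₀)·v)^σ dν(v) = C · (∫_{L_∞}∫_{L⁺_∞} (∏_{w∣∞}((1+½‖X_w‖²)² + (wδ)²·(ι s)_w²))^{−σ} dμ_{F,∞} dμ_{E,∞}) · (∏_{v ∈ S₀} a_v(σ)) · N^{S₀}(σ)∕D^{S₀}(σ)`,
`N^{S₀} = ζ^{S₀}(σ−1)·L^{S₀}(σ−1,ε)·L^{S₀}(2σ−2,ε)`, `D^{S₀} = ζ^{S₀}(σ)·L^{S₀}(σ,ε)·L^{S₀}(2σ−1,ε)`, `ε = ε_{L∕L⁺}` (★ FILE 1 `partialStandardL` currency VERBATIM), `a_v(σ)` the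
normalised local means of ★ (3-iii-b2) at the bad places.  (§1 ∘ ★ (ν-1) ∘ ★ `exists_integral_adele_eq_smul_integral_prod` ×2 ∘ `integral_prod_mul` ×2 ∘ `integral_prod` ∘ ★ (3-iv-b).)
[cite: MoeglinWaldspurger1995, II.1.7, IV.1.11] [cite: Langlands1971, §3] [cite: Rogawski1990, §4.5] -/
theorem exists_pos_inv_measure_smul_integral_rpow_borelHeight_eq_eulerProduct_three {d : ↥(maximalRealSubfield L)} (hd : δ * δ = algebraMap ↥(maximalRealSubfield L) L d)
    [MeasurableSpace ↥(adelicUnipotent ↥(maximalRealSubfield L) L (IsCMField.complexConj L) 3)] [BorelSpace ↥(adelicUnipotent ↥(maximalRealSubfield L) L (IsCMField.complexConj L) 3)]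
    [MeasurableSpace (AdeleRing (𝓞 L) L)] [BorelSpace (AdeleRing (𝓞 L) L)]
    [MeasurableSpace (AdeleRing (𝓞 ↥(maximalRealSubfield L)) ↥(maximalRealSubfield L))] [BorelSpace (AdeleRing (𝓞 ↥(maximalRealSubfield L)) ↥(maximalRealSubfield L))]
    [MeasurableSpace (InfiniteAdeleRing L)] [BorelSpace (InfiniteAdeleRing L)]
    [MeasurableSpace (InfiniteAdeleRing ↥(maximalRealSubfield L))] [BorelSpace (InfiniteAdeleRing ↥(maximalRealSubfield L))]
    [MeasurableSpace (FiniteAdeleRing (𝓞 L) L)] [BorelSpace (FiniteAdeleRing (𝓞 L) L)]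
    [MeasurableSpace (FiniteAdeleRing (𝓞 ↥(maximalRealSubfield L)) ↥(maximalRealSubfield L))] [BorelSpace (FiniteAdeleRing (𝓞 ↥(maximalRealSubfield L)) ↥(maximalRealSubfield L))]
    [∀ v : HeightOneSpectrum (𝓞 ↥(maximalRealSubfield L)), MeasurableSpace (v.adicCompletion ↥(maximalRealSubfield L))] [∀ v : HeightOneSpectrum (𝓞 ↥(maximalRealSubfield L)), BorelSpace (v.adicCompletion ↥(maximalRealSubfield L))]
    (ν : Measure ↥(adelicUnipotent ↥(maximalRealSubfield L) L (IsCMField.complexConj L) 3)) [ν.IsHaarMeasure]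
    {𝓕 : Set ↥(adelicUnipotent ↥(maximalRealSubfield L) L (IsCMField.complexConj L) 3)} (h𝓕 : IsFundamentalDomain ↥(rationalUnipotent ↥(maximalRealSubfield L) L (IsCMField.complexConj L) 3) 𝓕 ν)
    (μE : Measure (AdeleRing (𝓞 L) L)) [μE.IsAddHaarMeasure] (μE₁ : Measure (InfiniteAdeleRing L)) [μE₁.IsAddHaarMeasure]
    (μE₂ : Measure (FiniteAdeleRing (𝓞 L) L)) [μE₂.IsAddHaarMeasure]
    (μF : Measure (AdeleRing (𝓞 ↥(maximalRealSubfield L)) ↥(maximalRealSubfield L))) [μF.IsAddHaarMeasure] (μF₁ : Measure (InfiniteAdeleRing ↥(maximalRealSubfield L))) [μF₁.IsAddHaarMeasure]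
    (μF₂ : Measure (FiniteAdeleRing (𝓞 ↥(maximalRealSubfield L)) ↥(maximalRealSubfield L))) [μF₂.IsAddHaarMeasure]
    (νv : ∀ v : HeightOneSpectrum (𝓞 ↥(maximalRealSubfield L)), Measure (v.adicCompletion ↥(maximalRealSubfield L))) [∀ v, (νv v).IsAddHaarMeasure] :
    ∃ C : ℝ, 0 < C ∧ ∀ (S₀ : Finset (HeightOneSpectrum (𝓞 ↥(maximalRealSubfield L))))
      (hgood : ∀ v ∉ S₀, Algebra.IsUnramifiedIn (𝓞 L) v.asIdeal ∧ Valued.v (2 : v.adicCompletion ↥(maximalRealSubfield L)) = 1 ∧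
        ∀ w : PlacesOver L v, Valued.v (algebraMap L (LocalRing L v) δ w) = 1) {σ : ℝ} (hσ : 2 < σ)
      (hT : Integrable (fun v : ↥(adelicUnipotent ↥(maximalRealSubfield L) L (IsCMField.complexConj L) 3) =>
        ((((borelHeight (((quasiSplit (↥(maximalRealSubfield L)) L (IsCMField.complexConj L) 3).toAdelic (weylLongU ((IsCMField.complexConj L : L ≃ₐ[↥(maximalRealSubfield L)] L) : L →+* L) (rfl : ((StdForm.antidiagonal 3).over L) = ((StdForm.antidiagonal 3).over L)))) * (v : (quasiSplit (↥(maximalRealSubfield L)) L (IsCMField.complexConj L) 3).Adelic))) : ℝ) ^ σ : ℝ) : ℂ)) ν)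
      (hfin : Integrable (fun q : FiniteAdeleRing (𝓞 L) L × FiniteAdeleRing (𝓞 ↥(maximalRealSubfield L)) ↥(maximalRealSubfield L) =>
        ((((∏ᶠ w : HeightOneSpectrum (𝓞 L), max 1 (max ‖((((0 : InfiniteAdeleRing L)), q.1) : AdeleRing (𝓞 L) L).2 w‖₊
              ‖(heisZ (c := IsCMField.complexConj L) ((((0 : InfiniteAdeleRing L)), q.1) : AdeleRing (𝓞 L) L)
                ((traceZeroLine ↥(maximalRealSubfield L) L (IsCMField.complexConj L) hcδ hδ
                  ((0, q.2) : AdeleRing (𝓞 ↥(maximalRealSubfield L)) ↥(maximalRealSubfield L)) :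
                    traceZeroAdele ↥(maximalRealSubfield L) L (IsCMField.complexConj L)) : AdeleRing (𝓞 L) L)).2 w‖₊) : ℝ≥0) : ℝ) ^ (-σ) : ℝ) : ℂ)) (μE₂.prod μF₂)),
      ((ν 𝓕).toReal⁻¹ : ℝ) • ∫ v : ↥(adelicUnipotent ↥(maximalRealSubfield L) L (IsCMField.complexConj L) 3),
          ((((borelHeight (((quasiSplit (↥(maximalRealSubfield L)) L (IsCMField.complexConj L) 3).toAdelic (weylLongU ((IsCMField.complexConj L : L ≃ₐ[↥(maximalRealSubfield L)] L) : L →+* L) (rfl : ((StdForm.antidiagonal 3).over L) = ((StdForm.antidiagonal 3).over L)))) * (v : (quasiSplit (↥(maximalRealSubfield L)) L (IsCMField.complexConj L) 3).Adelic))) : ℝ) ^ σ : ℝ) : ℂ) ∂ν =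
        (C : ℂ) * (∫ Xi : InfiniteAdeleRing L, ∫ a : InfiniteAdeleRing ↥(maximalRealSubfield L), ((((∏ w : InfinitePlace L, ((1 + ‖(Xi) w‖ ^ 2 / 2) ^ 2 + (w δ) ^ 2 * (((InfiniteAdeleRing.ringEquiv_mixedSpace ↥(maximalRealSubfield L)) a).1 ⟨w.comap (algebraMap ↥(maximalRealSubfield L) L), K2E1HeightBigCellLineFormulaU2.isReal_comap_maximalRealSubfield L w⟩) ^ 2))) ^ (-σ) : ℝ) : ℂ) ∂μF₁ ∂μE₁) *
          ((∏ v ∈ S₀, ((Measure.pi fun _ : Fin 3 => νv v) (integralBox ↥(maximalRealSubfield L) (Fin 3) v)).toReal⁻¹ •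
              ∫ p : Fin 3 → v.adicCompletion ↥(maximalRealSubfield L),
                (((∏ w' : PlacesOver L v, max 1 (max ((normAbs (w'.1.adicCompletion L) (quadraticLocalEquiv L v (IsCMField.complexConj L) hcδ hδ (p 0, p 1) w') : ℝ≥0) : ℝ)
                  ((normAbs (w'.1.adicCompletion L) ((toLocalRing L v (p 2) * algebraMap L (LocalRing L v) δ -
                    toLocalRing L v 2⁻¹ * (quadraticLocalEquiv L v (IsCMField.complexConj L) hcδ hδ (p 0, p 1) *
                      conjLocal L (IsCMField.complexConj L) v (quadraticLocalEquiv L v (IsCMField.complexConj L) hcδ hδ (p 0, p 1)))) w') : ℝ≥0) : ℝ))) ^ (-σ) : ℝ) : ℂ)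
                ∂(Measure.pi fun _ : Fin 3 => νv v)) *
            ((partialStandardL (↑S₀ : Set (HeightOneSpectrum (𝓞 ↥(maximalRealSubfield L)))) (fun _ => {1}) ((σ : ℂ) - 1) * partialStandardL (↑S₀ : Set (HeightOneSpectrum (𝓞 ↥(maximalRealSubfield L)))) (fun v => {(quadraticHeckeCharCM L).valueAtUniformizer v}) ((σ : ℂ) - 1) *
                partialStandardL (↑S₀ : Set (HeightOneSpectrum (𝓞 ↥(maximalRealSubfield L)))) (fun v => {(quadraticHeckeCharCM L).valueAtUniformizer v}) (2 * (σ : ℂ) - 2)) /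
              (partialStandardL (↑S₀ : Set (HeightOneSpectrum (𝓞 ↥(maximalRealSubfield L)))) (fun _ => {1}) (σ : ℂ) * partialStandardL (↑S₀ : Set (HeightOneSpectrum (𝓞 ↥(maximalRealSubfield L)))) (fun v => {(quadraticHeckeCharCM L).valueAtUniformizer v}) (σ : ℂ) *
                partialStandardL (↑S₀ : Set (HeightOneSpectrum (𝓞 ↥(maximalRealSubfield L)))) (fun v => {(quadraticHeckeCharCM L).valueAtUniformizer v}) (2 * (σ : ℂ) - 1)))) := by
  haveI : SecondCountableTopology (FiniteAdeleRing (𝓞 ↥(maximalRealSubfield L)) ↥(maximalRealSubfield L)) := secondCountableTopology_finiteAdeleRing _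
  haveI : LocallyCompactSpace (FiniteAdeleRing (𝓞 ↥(maximalRealSubfield L)) ↥(maximalRealSubfield L)) := locallyCompactSpace_finiteAdeleRing' _
  haveI : SecondCountableTopology (FiniteAdeleRing (𝓞 L) L) := secondCountableTopology_finiteAdeleRing L
  haveI : LocallyCompactSpace (FiniteAdeleRing (𝓞 L) L) := locallyCompactSpace_finiteAdeleRing' L
  haveI : SecondCountableTopology (InfiniteAdeleRing L) := secondCountableTopology_infiniteAdeleRing L
  haveI : SecondCountableTopology (InfiniteAdeleRing ↥(maximalRealSubfield L)) := secondCountableTopology_infiniteAdeleRing _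
  obtain ⟨cF, hcF, hF⟩ := exists_integral_adele_eq_smul_integral_prod ↥(maximalRealSubfield L) μF μF₁ μF₂
  obtain ⟨cE, hcE, hE⟩ := exists_integral_adele_eq_smul_integral_prod L μE μE₁ μE₂
  obtain ⟨C', hC', hfinite⟩ := exists_pos_integral_prod_heightFactor_rpow_eq L μF₂ μE₂ hcδ hδ hd νv
  have hκE : 0 < (μE (adeleFundamentalDomain L)).toReal⁻¹ := inv_pos.2 (measure_adeleFundamentalDomain_toReal_pos μE)
  have hκF : 0 < (μF (adeleFundamentalDomain ↥(maximalRealSubfield L))).toReal⁻¹ := inv_pos.2 (measure_adeleFundamentalDomain_toReal_pos μF)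
  have hbox : 0 < ((Measure.pi fun _ : Fin 3 => μF₂) (offBox (K := ↥(maximalRealSubfield L)) (ι := Fin 3) ∅)).toReal :=
    ENNReal.toReal_pos (measure_offBox_empty_pos ↥(maximalRealSubfield L) (Fin 3) _).ne' (measure_offBox_empty_lt_top ↥(maximalRealSubfield L) (Fin 3) _).ne
  refine ⟨(μE (adeleFundamentalDomain L)).toReal⁻¹ * cE * ((μF (adeleFundamentalDomain ↥(maximalRealSubfield L))).toReal⁻¹ * cF) *
      (C' * ((Measure.pi fun _ : Fin 3 => μF₂) (offBox (K := ↥(maximalRealSubfield L)) (ι := Fin 3) ∅)).toReal), by positivity,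
    fun S₀ hgood σ hσ hT hfin => ?_⟩
  -- ★ (ν-1): unfold `N(𝔸)` along the Heisenberg chart and the trace-zero line; §1 pointwise
  rw [inv_measure_smul_integral_eq_heisChart_traceZeroLine_three hcδ hδ hc μF μE ν h𝓕 hT]
  simp_rw [rpow_borelHeight_weylLongU_heisChart_eq L hc hcδ hδ σ]
  -- the `s`-integral: `𝔸_{L⁺} = L⁺_∞ × 𝔸_{L⁺,f}`, then `integral_prod_mul`
  have hinner : ∀ X : AdeleRing (𝓞 L) L,
      ∫ s : AdeleRing (𝓞 ↥(maximalRealSubfield L)) ↥(maximalRealSubfield L), ((((∏ w : InfinitePlace L, ((1 + ‖(X.1) w‖ ^ 2 / 2) ^ 2 + (w δ) ^ 2 * (((InfiniteAdeleRing.ringEquiv_mixedSpace ↥(maximalRealSubfield L)) s.1).1 ⟨w.comap (algebraMap ↥(maximalRealSubfield L) L), K2E1HeightBigCellLineFormulaU2.isReal_comap_maximalRealSubfield L w⟩) ^ 2))) ^ (-σ) : ℝ) : ℂ) *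
          ((((∏ᶠ w : HeightOneSpectrum (𝓞 L), max 1 (max ‖((X) : AdeleRing (𝓞 L) L).2 w‖₊
              ‖(heisZ (c := IsCMField.complexConj L) ((X) : AdeleRing (𝓞 L) L)
                ((traceZeroLine ↥(maximalRealSubfield L) L (IsCMField.complexConj L) hcδ hδ
                  ((0, s.2) : AdeleRing (𝓞 ↥(maximalRealSubfield L)) ↥(maximalRealSubfield L)) :
                    traceZeroAdele ↥(maximalRealSubfield L) L (IsCMField.complexConj L)) : AdeleRing (𝓞 L) L)).2 w‖₊) : ℝ≥0) : ℝ) ^ (-σ) : ℝ) : ℂ) ∂μF =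
        (cF : ℝ) • ((∫ a : InfiniteAdeleRing ↥(maximalRealSubfield L), ((((∏ w : InfinitePlace L, ((1 + ‖(X.1) w‖ ^ 2 / 2) ^ 2 + (w δ) ^ 2 * (((InfiniteAdeleRing.ringEquiv_mixedSpace ↥(maximalRealSubfield L)) a).1 ⟨w.comap (algebraMap ↥(maximalRealSubfield L) L), K2E1HeightBigCellLineFormulaU2.isReal_comap_maximalRealSubfield L w⟩) ^ 2))) ^ (-σ) : ℝ) : ℂ) ∂μF₁) *
          ∫ b : FiniteAdeleRing (𝓞 ↥(maximalRealSubfield L)) ↥(maximalRealSubfield L), ((((∏ᶠ w : HeightOneSpectrum (𝓞 L), max 1 (max ‖((((0 : InfiniteAdeleRing L)), X.2) : AdeleRing (𝓞 L) L).2 w‖₊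
              ‖(heisZ (c := IsCMField.complexConj L) ((((0 : InfiniteAdeleRing L)), X.2) : AdeleRing (𝓞 L) L)
                ((traceZeroLine ↥(maximalRealSubfield L) L (IsCMField.complexConj L) hcδ hδ
                  ((0, b) : AdeleRing (𝓞 ↥(maximalRealSubfield L)) ↥(maximalRealSubfield L)) :
                    traceZeroAdele ↥(maximalRealSubfield L) L (IsCMField.complexConj L)) : AdeleRing (𝓞 L) L)).2 w‖₊) : ℝ≥0) : ℝ) ^ (-σ) : ℝ) : ℂ) ∂μF₂) := by
    intro X
    rw [hF (fun a b => ((((∏ w : InfinitePlace L, ((1 + ‖(X.1) w‖ ^ 2 / 2) ^ 2 + (w δ) ^ 2 * (((InfiniteAdeleRing.ringEquiv_mixedSpace ↥(maximalRealSubfield L)) a).1 ⟨w.comap (algebraMap ↥(maximalRealSubfield L) L), K2E1HeightBigCellLineFormulaU2.isReal_comap_maximalRealSubfield L w⟩) ^ 2))) ^ (-σ) : ℝ) : ℂ) *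
      ((((∏ᶠ w : HeightOneSpectrum (𝓞 L), max 1 (max ‖((X) : AdeleRing (𝓞 L) L).2 w‖₊
              ‖(heisZ (c := IsCMField.complexConj L) ((X) : AdeleRing (𝓞 L) L)
                ((traceZeroLine ↥(maximalRealSubfield L) L (IsCMField.complexConj L) hcδ hδ
                  ((0, b) : AdeleRing (𝓞 ↥(maximalRealSubfield L)) ↥(maximalRealSubfield L)) :
                    traceZeroAdele ↥(maximalRealSubfield L) L (IsCMField.complexConj L)) : AdeleRing (𝓞 L) L)).2 w‖₊) : ℝ≥0) : ℝ) ^ (-σ) : ℝ) : ℂ)),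
      integral_prod_mul (μ := μF₁) (ν := μF₂) (fun a : InfiniteAdeleRing ↥(maximalRealSubfield L) => ((((∏ w : InfinitePlace L, ((1 + ‖(X.1) w‖ ^ 2 / 2) ^ 2 + (w δ) ^ 2 * (((InfiniteAdeleRing.ringEquiv_mixedSpace ↥(maximalRealSubfield L)) a).1 ⟨w.comap (algebraMap ↥(maximalRealSubfield L) L), K2E1HeightBigCellLineFormulaU2.isReal_comap_maximalRealSubfield L w⟩) ^ 2))) ^ (-σ) : ℝ) : ℂ))
        (fun b : FiniteAdeleRing (𝓞 ↥(maximalRealSubfield L)) ↥(maximalRealSubfield L) => ((((∏ᶠ w : HeightOneSpectrum (𝓞 L), max 1 (max ‖((X) : AdeleRing (𝓞 L) L).2 w‖₊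
              ‖(heisZ (c := IsCMField.complexConj L) ((X) : AdeleRing (𝓞 L) L)
                ((traceZeroLine ↥(maximalRealSubfield L) L (IsCMField.complexConj L) hcδ hδ
                  ((0, b) : AdeleRing (𝓞 ↥(maximalRealSubfield L)) ↥(maximalRealSubfield L)) :
                    traceZeroAdele ↥(maximalRealSubfield L) L (IsCMField.complexConj L)) : AdeleRing (𝓞 L) L)).2 w‖₊) : ℝ≥0) : ℝ) ^ (-σ) : ℝ) : ℂ))]
    rfl
  simp_rw [hinner]
  -- the `X`-integral: `𝔸_L = L_∞ × 𝔸_{L,f}`, then `integral_prod_mul`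
  rw [hE (fun x1 x2 => ((μF (adeleFundamentalDomain ↥(maximalRealSubfield L))).toReal⁻¹ : ℂ) * ((cF : ℝ) • ((∫ a : InfiniteAdeleRing ↥(maximalRealSubfield L), ((((∏ w : InfinitePlace L, ((1 + ‖(x1) w‖ ^ 2 / 2) ^ 2 + (w δ) ^ 2 * (((InfiniteAdeleRing.ringEquiv_mixedSpace ↥(maximalRealSubfield L)) a).1 ⟨w.comap (algebraMap ↥(maximalRealSubfield L) L), K2E1HeightBigCellLineFormulaU2.isReal_comap_maximalRealSubfield L w⟩) ^ 2))) ^ (-σ) : ℝ) : ℂ) ∂μF₁) *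
      ∫ b : FiniteAdeleRing (𝓞 ↥(maximalRealSubfield L)) ↥(maximalRealSubfield L), ((((∏ᶠ w : HeightOneSpectrum (𝓞 L), max 1 (max ‖((((0 : InfiniteAdeleRing L)), x2) : AdeleRing (𝓞 L) L).2 w‖₊
              ‖(heisZ (c := IsCMField.complexConj L) ((((0 : InfiniteAdeleRing L)), x2) : AdeleRing (𝓞 L) L)
                ((traceZeroLine ↥(maximalRealSubfield L) L (IsCMField.complexConj L) hcδ hδ
                  ((0, b) : AdeleRing (𝓞 ↥(maximalRealSubfield L)) ↥(maximalRealSubfield L)) :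
                    traceZeroAdele ↥(maximalRealSubfield L) L (IsCMField.complexConj L)) : AdeleRing (𝓞 L) L)).2 w‖₊) : ℝ≥0) : ℝ) ^ (-σ) : ℝ) : ℂ) ∂μF₂)))]
  simp_rw [Complex.real_smul]
  rw [integral_const_mul, integral_const_mul,
    integral_prod_mul (μ := μE₁) (ν := μE₂) (fun x1 : InfiniteAdeleRing L => ∫ a : InfiniteAdeleRing ↥(maximalRealSubfield L), ((((∏ w : InfinitePlace L, ((1 + ‖(x1) w‖ ^ 2 / 2) ^ 2 + (w δ) ^ 2 * (((InfiniteAdeleRing.ringEquiv_mixedSpace ↥(maximalRealSubfield L)) a).1 ⟨w.comap (algebraMap ↥(maximalRealSubfield L) L), K2E1HeightBigCellLineFormulaU2.isReal_comap_maximalRealSubfield L w⟩) ^ 2))) ^ (-σ) : ℝ) : ℂ) ∂μF₁)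
      (fun x2 : FiniteAdeleRing (𝓞 L) L => ∫ b : FiniteAdeleRing (𝓞 ↥(maximalRealSubfield L)) ↥(maximalRealSubfield L), ((((∏ᶠ w : HeightOneSpectrum (𝓞 L), max 1 (max ‖((((0 : InfiniteAdeleRing L)), x2) : AdeleRing (𝓞 L) L).2 w‖₊
              ‖(heisZ (c := IsCMField.complexConj L) ((((0 : InfiniteAdeleRing L)), x2) : AdeleRing (𝓞 L) L)
                ((traceZeroLine ↥(maximalRealSubfield L) L (IsCMField.complexConj L) hcδ hδ
                  ((0, b) : AdeleRing (𝓞 ↥(maximalRealSubfield L)) ↥(maximalRealSubfield L)) :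
                    traceZeroAdele ↥(maximalRealSubfield L) L (IsCMField.complexConj L)) : AdeleRing (𝓞 L) L)).2 w‖₊) : ℝ≥0) : ℝ) ^ (-σ) : ℝ) : ℂ) ∂μF₂)]
  -- Fubini on the finite part (the letter `hfin`), then ★ (3-iv-b)
  have hfub : ∫ x2 : FiniteAdeleRing (𝓞 L) L, ∫ b : FiniteAdeleRing (𝓞 ↥(maximalRealSubfield L)) ↥(maximalRealSubfield L), ((((∏ᶠ w : HeightOneSpectrum (𝓞 L), max 1 (max ‖((((0 : InfiniteAdeleRing L)), x2) : AdeleRing (𝓞 L) L).2 w‖₊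
              ‖(heisZ (c := IsCMField.complexConj L) ((((0 : InfiniteAdeleRing L)), x2) : AdeleRing (𝓞 L) L)
                ((traceZeroLine ↥(maximalRealSubfield L) L (IsCMField.complexConj L) hcδ hδ
                  ((0, b) : AdeleRing (𝓞 ↥(maximalRealSubfield L)) ↥(maximalRealSubfield L)) :
                    traceZeroAdele ↥(maximalRealSubfield L) L (IsCMField.complexConj L)) : AdeleRing (𝓞 L) L)).2 w‖₊) : ℝ≥0) : ℝ) ^ (-σ) : ℝ) : ℂ) ∂μF₂ ∂μE₂ =
      ∫ q : FiniteAdeleRing (𝓞 L) L × FiniteAdeleRing (𝓞 ↥(maximalRealSubfield L)) ↥(maximalRealSubfield L), ((((∏ᶠ w : HeightOneSpectrum (𝓞 L), max 1 (max ‖((((0 : InfiniteAdeleRing L)), q.1) : AdeleRing (𝓞 L) L).2 w‖₊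
              ‖(heisZ (c := IsCMField.complexConj L) ((((0 : InfiniteAdeleRing L)), q.1) : AdeleRing (𝓞 L) L)
                ((traceZeroLine ↥(maximalRealSubfield L) L (IsCMField.complexConj L) hcδ hδ
                  ((0, q.2) : AdeleRing (𝓞 ↥(maximalRealSubfield L)) ↥(maximalRealSubfield L)) :
                    traceZeroAdele ↥(maximalRealSubfield L) L (IsCMField.complexConj L)) : AdeleRing (𝓞 L) L)).2 w‖₊) : ℝ≥0) : ℝ) ^ (-σ) : ℝ) : ℂ) ∂(μE₂.prod μF₂) :=
    (integral_prod _ hfin).symm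
  rw [hfub, hfinite 0 S₀ hgood hσ hfin]
  simp only [Complex.real_smul]
  push_cast
  ring

end Summit.HodgeConjecture.HodgeConjecture.Cruxes.H413.K2E1IntertwiningScalarEulerProductU3

end
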